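import Summits.CriticalPhenomena.PercolationContinuityZ3.Theorems.Transplant.SkelPhiCorridorKGRoomsQYUV
import Summits.CriticalPhenomena.PercolationContinuityZ3.Theorems.Transplant.SkelFrmBChoiceDefsV
import Summits.CriticalPhenomena.PercolationContinuityZ3.Theorems.Transplant.SkelFrmBChoiceGeomV
import Summits.CriticalPhenomena.PercolationContinuityZ3.Theorems.Transplant.SkelFrmBChoiceAtQV
import Summits.CriticalPhenomena.PercolationContinuityZ3.Theorems.Transplant.SkelFrmBChoiceRoomsV
import Summits.CriticalPhenomena.PercolationContinuityZ3.Theorems.Transplant.SkelFrmBChoiceNums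
import Summits.CriticalPhenomena.PercolationContinuityZ3.Theorems.Transplant.SkelFrmBParamsSchedAT
import Summits.CriticalPhenomena.PercolationContinuityZ3.Theorems.Transplant.SkelFrmBParamsCorrKG
import Summits.CriticalPhenomena.PercolationContinuityZ3.Theorems.Transplant.SkelFrm1ReachRowsQD
import Summits.CriticalPhenomena.PercolationContinuityZ3.Theorems.Transplant.SkelPhiCorridorKGBoxes2
import HarnessLib

/-!
((R-45) V PORT of `SkelFrm1ReachRowsQUT` (p5-g16 port, p5-g17 verification; rulings lead g12 11:31:15Z, design owner p3-g17 (R-44)/(R-45)): the cell layer `PCells2T` ↦ `PCells2V`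
(per-axis ASYMMETRIC transverse room `σ·[−hB, hF]`, PlanarCells2VDefs, hp-8 g42/g43), names per hp-8's renamedV/modmapV + the stmt-g21/g22 V choice layer (forward-room slot `hv`);
cell-free lemmas are NOT re-declared (imported from the S/T originals). Text otherwise verbatim except the across-room reading rows `±2·r⊥ ↦ (−hB du.1 + 1, hF du.1 − 1)`.)
(J17 / (R-39): the UNION-PRISM twin of the second-axis half of SkelFrm1ReachRowsQD — `reachOblAtHNF_frmQ3VD_sndU` over `reachOblAtHNF_of_kgCorrYVU`
(schedule `kgCorrSchedYU`, PER-REGION reading rows `hPR`); text otherwise verbatim.)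
# N2 (frames-only node `SamePDropOfSkeletonFrm₁`, OPEN), (C) column: THE CORRIDOR RESIDUE OF THE CHOICE FUNCTION OF RECORD AT ONE PROBE, FIRST AXIS,
# EVERY STRUCTURAL BINDER DISCHARGED, ENTRANCE DEPTH A HYPOTHESIS (J15) — `PlanarSkeletonFrm.NegB.reachOblAtHNF_frmQ3VD_fst/_snd`

`Skelφ.reachOblAtHNF_of_kgCorrVD/YSD` (SkelPhiCorridorKGRoomsQD/QYD, the J15 twins with the entrance depth `hdeep` a hypothesis) instantiated at the scheme of record `⟨ΓQV κ Φ t p O gv fv Sv cv hv bv q, q, κ.δ⟩` of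
`NegB.choiceAtQ3V` (SkelFrmBChoiceDefs3) under `AtQNQ O q`, onward direction `((0 : Fin 2), true)`: the fine map `fineOA` (= `fineSkel` at the lattice record
`prFA`, by `rfl`), its Lipschitz/weak-step facts, the Γ package (`geom_fineA_at_bV`), the long frame `φL` (`lip_φL/steps_φL`, `|h_L| ≤ 10 n_L` from
`clauseL_of_atQV`), the column origin `colVT (tgt e)` (`colVT_eq`, `colVT_mem_graphBall_lin`), the (S0) kit block `KS0.kit0` with ALL its constant rows
(`kit0_ok/kit0_sizes/hr₀_kit0/hreach_kit0`, `r₀ := r₀0 … Rl`), the short region `KS.RgK` (`RgK_subset_graphBall`, `card_RgK_le`), the zone datum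
`Λ c M_u` (`hΛRg_of_atQV`, `hzconn_of_atQV`, `c ∈ Λ c M_u`), the kit levels/counts at the flat root accuracy `κ.δr 0` (`KS0.j₀0/j₁0/Rlev0/R'0`, `hNk0_at`,
`counts_atq_root`), and the long links in their literal shape (`hlong_of_atQ3V/hlongY_of_atQ3V`, p3-g16) are ALL DISCHARGED here; the corridor enters through
`ParkOK` of the two parking records at `R′ := KS0.R'0`, `ρ := 0` (J14a; stmt-g20's `kgRows0_of….kgVals_ok₁/ok₂/split`), and what stays a hypothesis is
NUMERIC ONLY plus the entrance depth — the radius rows of the schedule `schedOfT … (Sv … q)`, the reading rows of the prism box / arrival box / start box at the lattice record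
`prFA`, the depth row, the world rows of the rim-excess device, and the budget `nmax` (stmt-g20's Radii/SlotsS/CorrKG0/Len files discharge them by name).
The landed `reachOblAtHNF_frmQ3_fst/_snd` (SkelFrm1ReachRowsQ, over the landed RoomsQ/QY with `hRC/hRB`) are superseded in use (J15: their radius row set is unsatisfiable at the schedule of record).
builds on p205010 (kernel theorem, internal audit signed; external expert review pending) — nothing in this file uses p205010; nothing here is a claim
about the open node `SamePDropOfSkeletonFrm₁`.
Lane `prim-bschramm`, seat `prim-bschramm-p5` (gen 16 port, gen 17 verification; (C) lineage); helper file (`--supports stmt-CriticalPhenomena-4575 --as helper`).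
[cite: KozmaNitzan2024, §4 Lemma 12 (pp. 23–25), pp. 25–27, p. 30 (Step IV)] [cite: MartineauTassion2017, §4.3 Lemma 4.2]
-/

noncomputable section

open MeasureTheory ProbabilityTheory
open scoped ENNReal Classical

namespace Summit.CriticalPhenomena.PercolationContinuityZ3.Theorems.Transplant

namespace PlanarSkeletonFrm

open Literature.Probability.Percolation Literature.Probability.LatticeModels SimpleGraph GadgetSystem ProbeHistory HSiteScheme Contour KNCells
open Literature.Probability.Percolation.KozmaNitzan.Cells (oth sgOf)
open KNCells.KSchA KNLevels ChainPlanar ChainPara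
open Literature.Barriers.CriticalPhenomena (HasExponentialGrowth graphBall graphBall_mono mem_graphBall_self)
open Skel (ReachOblAtHNF excess)
open SkelI (tanOff)
open SkelConc (Consts)
open BoxProdZ2 (ConcRadiiG)
open TwoAxis.Para (modulus)
open Skelφ (oriφ trφ)
open Skelφ.StepI (DataN DataNS OutNS)

namespace NegB

open Neg

section Fst

variable {κ : Consts} {V : Type} [DecidableEq V] [Countable V] {G : SimpleGraph V} [G.LocallyFinite] {Φ : PlanarSkeletonFrm G} {t : V} {p : unitInterval}
  {hC : Φ.CylSubcritical p} {gv fv : Neg.FSlot} {Pv : PSlot} {Sv : SSlot} {cv hv : CSlot} {bv : BSlot} {O : OutNS V} {q : unitInterval}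



/-- **THE (C) RESIDUE OF THE CHOICE FUNCTION OF RECORD AT ONE PROBE, SECOND AXIS** (over `reachOblAtHNF_of_kgCorrYV`; the schedule's frame rows are the
`KGYRows` fields `hn/hv/hlay`). [cite: KozmaNitzan2024, §4 Lemma 12 (pp. 23–25), p. 30 (Step IV)] -/
theorem reachOblAtHNF_frmQ3VD_sndU (hAt : (choiceAtQ3V κ Φ t p Pv gv fv Sv cv hv bv hC).AtQNQ O q) (h1 : Φ.types = {t})
    (hp0 : 0 < (p : ℝ)) (hp1 : (p : ℝ) < 1) (mk : ℕ)
    -- the probe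
    {h : ProbeHistory V} {e : Site 2 × MDir} (hV : (((KSchA.mk (ΓQV κ Φ t p O gv fv Sv cv hv bv q) q κ.δ : KSchA V ℕ))).Valid₂O G h e) (hdu : ((((1 : Fin 2), true) : MDir)) ∈ (((KSchA.mk (ΓQV κ Φ t p O gv fv Sv cv hv bv q) q κ.δ : KSchA V ℕ))).onwardO G h (tgt e)) (hne : ((((1 : Fin 2), true) : MDir)) ≠ rev e.2)
    -- the corridor of record, second axis: the K-G row set at `R′ := KS0.R'0` and a run length `N` (stmt-g20: `kgYRows0_of …`, `N := kgNYv0 …`)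
    {ρ qq W : ℕ} (HK : Skelφ.KGYRows (nL κ Φ t p O.merged (gOf κ Φ t p O gv) (fOf κ Φ t p O fv)) (ℓL κ Φ t p O.merged (gOf κ Φ t p O gv) (fOf κ Φ t p O fv)) (hL κ Φ t p O.merged (gOf κ Φ t p O gv) (fOf κ Φ t p O fv)) (vL κ Φ t p O.merged (gOf κ Φ t p O gv) (fOf κ Φ t p O fv)) (KS0.R'0 κ Φ t p O.merged mk) ρ qq W) (N : ℕ)
    -- the window radius
    {R : ℕ} (hr₀R : KS0.r₀0 t O.merged mk (RL κ Φ t p O gv fv) ≤ R)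
    -- RADIUS ROWS of the schedule of record
    (hDQ : R + 1 ≤ ((schedOfT κ Φ t p O.merged (gOf κ Φ t p O gv) (fOf κ Φ t p O fv) (cOf κ Φ t p O gv fv cv) (Sv κ Φ t p O.merged (gOf κ Φ t p O gv) (fOf κ Φ t p O fv) q))).rQ ((((KSchA.mk (ΓQV κ Φ t p O gv fv Sv cv hv bv q) q κ.δ : KSchA V ℕ))).aOf₁O G h e) (tgt e))
    (hDρ' : ∀ l, R + 1 ≤ ((schedOfT κ Φ t p O.merged (gOf κ Φ t p O gv) (fOf κ Φ t p O fv) (cOf κ Φ t p O gv fv cv) (Sv κ Φ t p O.merged (gOf κ Φ t p O gv) (fOf κ Φ t p O fv) q))).ρ ((((KSchA.mk (ΓQV κ Φ t p O gv fv Sv cv hv bv q) q κ.δ : KSchA V ℕ))).aOf₂O G h e) (tgt e) ((((1 : Fin 2), true) : MDir)) l)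
    (hρM : ∀ l, ((schedOfT κ Φ t p O.merged (gOf κ Φ t p O gv) (fOf κ Φ t p O fv) (cOf κ Φ t p O gv fv cv) (Sv κ Φ t p O.merged (gOf κ Φ t p O gv) (fOf κ Φ t p O fv) q))).ρ ((((KSchA.mk (ΓQV κ Φ t p O gv fv Sv cv hv bv q) q κ.δ : KSchA V ℕ))).aOf₂O G h e) (tgt e) ((((1 : Fin 2), true) : MDir)) l + 1 ≤ ((schedOfT κ Φ t p O.merged (gOf κ Φ t p O gv) (fOf κ Φ t p O fv) (cOf κ Φ t p O gv fv cv) (Sv κ Φ t p O.merged (gOf κ Φ t p O gv) (fOf κ Φ t p O fv) q))).rM ((((KSchA.mk (ΓQV κ Φ t p O gv fv Sv cv hv bv q) q κ.δ : KSchA V ℕ))).aOf₂O G h e) (tgt e + stepVec ((((1 : Fin 2), true) : MDir))))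
    -- THE ENTRANCE DEPTH (J15; the wrapper: `deep_of_run₂bOV`, `R₀ := E(nS α v)`)
    {R₀ : ℕ} (hdeep : ∀ a ∈ (((KSchA.mk (ΓQV κ Φ t p O gv fv Sv cv hv bv q) q κ.δ : KSchA V ℕ))).Vx G h, ∀ b ∈ (((KSchA.mk (ΓQV κ Φ t p O gv fv Sv cv hv bv q) q κ.δ : KSchA V ℕ))).Γ.Ewv ((((KSchA.mk (ΓQV κ Φ t p O gv fv Sv cv hv bv q) q κ.δ : KSchA V ℕ))).aOf₁O G h e) e.1 e.2 ∪ ((FDQV κ Φ t p O gv fv Sv cv hv q)).Hfull ((((KSchA.mk (ΓQV κ Φ t p O gv fv Sv cv hv bv q) q κ.δ : KSchA V ℕ))).aOf₂O G h e) (tgt e) ((((1 : Fin 2), true) : MDir)),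
      b ∉ (((KSchA.mk (ΓQV κ Φ t p O gv fv Sv cv hv bv q) q κ.δ : KSchA V ℕ))).Vx G h → G.Adj a b → a ∈ graphBall G t R₀)
    -- PER-REGION READING ROWS of the second-axis corridor (J17; boxes e.g. `kgCorrSchedY_region_run_box/_park₁_box/_park₂_box`)
    (hPR : ∀ k ≤ (Skelφ.kgCorrSchedY HK.hn HK.hv HK.hlay (HK.kgYVals_ok₁ N) (HK.kgYVals_ok₂ N) (HK.kgYVals_split N)).N, ∃ lo hi : Site 2,
      (Skelφ.kgCorrSchedY HK.hn HK.hv HK.hlay (HK.kgYVals_ok₁ N) (HK.kgYVals_ok₂ N) (HK.kgYVals_split N)).region k ⊆ Finset.Icc lo hi ∧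
      (-(5 * (((fcellsV κ Φ t p O.merged (gOf κ Φ t p O gv) (fOf κ Φ t p O fv) (cOf κ Φ t p O gv fv cv) (hOf κ Φ t p O gv fv hv))).r 1 : ℤ)) + 1 ≤ Skelφ.rdLo ((prFA κ Φ t p O.merged (gOf κ Φ t p O gv) (fOf κ Φ t p O fv))).A (nL κ Φ t p O.merged (gOf κ Φ t p O gv) (fOf κ Φ t p O fv)) (hL κ Φ t p O.merged (gOf κ Φ t p O gv) (fOf κ Φ t p O fv)) (vL κ Φ t p O.merged (gOf κ Φ t p O gv) (fOf κ Φ t p O fv)) (vβL κ Φ t p O.merged (gOf κ Φ t p O gv) (fOf κ Φ t p O fv)) ((prFA κ Φ t p O.merged (gOf κ Φ t p O gv) (fOf κ Φ t p O fv))).c₀ ((prFA κ Φ t p O.merged (gOf κ Φ t p O gv) (fOf κ Φ t p O fv))).c₁ ((prFA κ Φ t p O.merged (gOf κ Φ t p O gv) (fOf κ Φ t p O fv))).D lo hi 1 ∧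
        Skelφ.rdHi ((prFA κ Φ t p O.merged (gOf κ Φ t p O gv) (fOf κ Φ t p O fv))).A (nL κ Φ t p O.merged (gOf κ Φ t p O gv) (fOf κ Φ t p O fv)) (hL κ Φ t p O.merged (gOf κ Φ t p O gv) (fOf κ Φ t p O fv)) (vL κ Φ t p O.merged (gOf κ Φ t p O gv) (fOf κ Φ t p O fv)) (vβL κ Φ t p O.merged (gOf κ Φ t p O gv) (fOf κ Φ t p O fv)) ((prFA κ Φ t p O.merged (gOf κ Φ t p O gv) (fOf κ Φ t p O fv))).c₀ ((prFA κ Φ t p O.merged (gOf κ Φ t p O gv) (fOf κ Φ t p O fv))).c₁ ((prFA κ Φ t p O.merged (gOf κ Φ t p O gv) (fOf κ Φ t p O fv))).D lo hi 1 ≤ 22 * (((fcellsV κ Φ t p O.merged (gOf κ Φ t p O gv) (fOf κ Φ t p O fv) (cOf κ Φ t p O gv fv cv) (hOf κ Φ t p O gv fv hv))).r 1 : ℤ) - 1) ∧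
      (-(((fcellsV κ Φ t p O.merged (gOf κ Φ t p O gv) (fOf κ Φ t p O fv) (cOf κ Φ t p O gv fv cv) (hOf κ Φ t p O gv fv hv))).hB 1 : ℤ) + 1 ≤ Skelφ.rdLo ((prFA κ Φ t p O.merged (gOf κ Φ t p O gv) (fOf κ Φ t p O fv))).A (nL κ Φ t p O.merged (gOf κ Φ t p O gv) (fOf κ Φ t p O fv)) (hL κ Φ t p O.merged (gOf κ Φ t p O gv) (fOf κ Φ t p O fv)) (vL κ Φ t p O.merged (gOf κ Φ t p O gv) (fOf κ Φ t p O fv)) (vβL κ Φ t p O.merged (gOf κ Φ t p O gv) (fOf κ Φ t p O fv)) ((prFA κ Φ t p O.merged (gOf κ Φ t p O gv) (fOf κ Φ t p O fv))).c₀ ((prFA κ Φ t p O.merged (gOf κ Φ t p O gv) (fOf κ Φ t p O fv))).c₁ ((prFA κ Φ t p O.merged (gOf κ Φ t p O gv) (fOf κ Φ t p O fv))).D lo hi 0 ∧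
        Skelφ.rdHi ((prFA κ Φ t p O.merged (gOf κ Φ t p O gv) (fOf κ Φ t p O fv))).A (nL κ Φ t p O.merged (gOf κ Φ t p O gv) (fOf κ Φ t p O fv)) (hL κ Φ t p O.merged (gOf κ Φ t p O gv) (fOf κ Φ t p O fv)) (vL κ Φ t p O.merged (gOf κ Φ t p O gv) (fOf κ Φ t p O fv)) (vβL κ Φ t p O.merged (gOf κ Φ t p O gv) (fOf κ Φ t p O fv)) ((prFA κ Φ t p O.merged (gOf κ Φ t p O gv) (fOf κ Φ t p O fv))).c₀ ((prFA κ Φ t p O.merged (gOf κ Φ t p O gv) (fOf κ Φ t p O fv))).c₁ ((prFA κ Φ t p O.merged (gOf κ Φ t p O gv) (fOf κ Φ t p O fv))).D lo hi 0 ≤ (((fcellsV κ Φ t p O.merged (gOf κ Φ t p O gv) (fOf κ Φ t p O fv) (cOf κ Φ t p O gv fv cv) (hOf κ Φ t p O gv fv hv))).hF 1 : ℤ) - 1))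
    -- READING ROWS of the arrival box `[kgLastLoY, kgLastHiY]` (SkelPhiCorridorKGBoxes)
    (hLl : 20 * (((fcellsV κ Φ t p O.merged (gOf κ Φ t p O gv) (fOf κ Φ t p O fv) (cOf κ Φ t p O gv fv cv) (hOf κ Φ t p O gv fv hv))).r 1 : ℤ) - (bOf κ Φ t p O gv fv bv) 1 + 1 ≤ Skelφ.rdLo ((prFA κ Φ t p O.merged (gOf κ Φ t p O gv) (fOf κ Φ t p O fv))).A (nL κ Φ t p O.merged (gOf κ Φ t p O gv) (fOf κ Φ t p O fv)) (hL κ Φ t p O.merged (gOf κ Φ t p O gv) (fOf κ Φ t p O fv)) (vL κ Φ t p O.merged (gOf κ Φ t p O gv) (fOf κ Φ t p O fv)) (vβL κ Φ t p O.merged (gOf κ Φ t p O gv) (fOf κ Φ t p O fv)) ((prFA κ Φ t p O.merged (gOf κ Φ t p O gv) (fOf κ Φ t p O fv))).c₀ ((prFA κ Φ t p O.merged (gOf κ Φ t p O gv) (fOf κ Φ t p O fv))).c₁ ((prFA κ Φ t p O.merged (gOf κ Φ t p O gv) (fOf κ Φ t p O fv))).D (HK.kgLastLoY N) (HK.kgLastHiY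 N) 1 ∧
      5 * (((fcellsV κ Φ t p O.merged (gOf κ Φ t p O gv) (fOf κ Φ t p O fv) (cOf κ Φ t p O gv fv cv) (hOf κ Φ t p O gv fv hv))).r 1 : ℤ) ≤ Skelφ.rdLo ((prFA κ Φ t p O.merged (gOf κ Φ t p O gv) (fOf κ Φ t p O fv))).A (nL κ Φ t p O.merged (gOf κ Φ t p O gv) (fOf κ Φ t p O fv)) (hL κ Φ t p O.merged (gOf κ Φ t p O gv) (fOf κ Φ t p O fv)) (vL κ Φ t p O.merged (gOf κ Φ t p O gv) (fOf κ Φ t p O fv)) (vβL κ Φ t p O.merged (gOf κ Φ t p O gv) (fOf κ Φ t p O fv)) ((prFA κ Φ t p O.merged (gOf κ Φ t p O gv) (fOf κ Φ t p O fv))).c₀ ((prFA κ Φ t p O.merged (gOf κ Φ t p O gv) (fOf κ Φ t p O fv))).c₁ ((prFA κ Φ t p O.merged (gOf κ Φ t p O gv) (fOf κ Φ t p O fv))).D (HK.kgLastLoY N) (HK.kgLastHiY N) 1 ∧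
      Skelφ.rdHi ((prFA κ Φ t p O.merged (gOf κ Φ t p O gv) (fOf κ Φ t p O fv))).A (nL κ Φ t p O.merged (gOf κ Φ t p O gv) (fOf κ Φ t p O fv)) (hL κ Φ t p O.merged (gOf κ Φ t p O gv) (fOf κ Φ t p O fv)) (vL κ Φ t p O.merged (gOf κ Φ t p O gv) (fOf κ Φ t p O fv)) (vβL κ Φ t p O.merged (gOf κ Φ t p O gv) (fOf κ Φ t p O fv)) ((prFA κ Φ t p O.merged (gOf κ Φ t p O gv) (fOf κ Φ t p O fv))).c₀ ((prFA κ Φ t p O.merged (gOf κ Φ t p O gv) (fOf κ Φ t p O fv))).c₁ ((prFA κ Φ t p O.merged (gOf κ Φ t p O gv) (fOf κ Φ t p O fv))).D (HK.kgLastLoY N) (HK.kgLastHiY N) 1 ≤ 20 * (((fcellsV κ Φ t p O.merged (gOf κ Φ t p O gv) (fOf κ Φ t p O fv) (cOf κ Φ t p O gv fv cv) (hOf κ Φ t p O gv fv hv))).r 1 : ℤ) + (bOf κ Φ t p O gv fv bv) 1 - 1 ∧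
      Skelφ.rdHi ((prFA κ Φ t p O.merged (gOf κ Φ t p O gv) (fOf κ Φ t p O fv))).A (nL κ Φ t p O.merged (gOf κ Φ t p O gv) (fOf κ Φ t p O fv)) (hL κ Φ t p O.merged (gOf κ Φ t p O gv) (fOf κ Φ t p O fv)) (vL κ Φ t p O.merged (gOf κ Φ t p O gv) (fOf κ Φ t p O fv)) (vβL κ Φ t p O.merged (gOf κ Φ t p O gv) (fOf κ Φ t p O fv)) ((prFA κ Φ t p O.merged (gOf κ Φ t p O gv) (fOf κ Φ t p O fv))).c₀ ((prFA κ Φ t p O.merged (gOf κ Φ t p O gv) (fOf κ Φ t p O fv))).c₁ ((prFA κ Φ t p O.merged (gOf κ Φ t p O gv) (fOf κ Φ t p O fv))).D (HK.kgLastLoY N) (HK.kgLastHiY N) 1 ≤ 22 * (((fcellsV κ Φ t p O.merged (gOf κ Φ t p O gv) (fOf κ Φ t p O fv) (cOf κ Φ t p O gv fv cv) (hOf κ Φ t p O gv fv hv))).r 1 : ℤ))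
    (hLt : ((fcellsV κ Φ t p O.merged (gOf κ Φ t p O gv) (fOf κ Φ t p O fv) (cOf κ Φ t p O gv fv cv) (hOf κ Φ t p O gv fv hv))).cenS (tgt e + stepVec ((((1 : Fin 2), true) : MDir))) 0 - ((fcellsV κ Φ t p O.merged (gOf κ Φ t p O gv) (fOf κ Φ t p O fv) (cOf κ Φ t p O gv fv cv) (hOf κ Φ t p O gv fv hv))).cenS (tgt e) 0 - (bOf κ Φ t p O gv fv bv) 0 + 1 ≤ Skelφ.rdLo ((prFA κ Φ t p O.merged (gOf κ Φ t p O gv) (fOf κ Φ t p O fv))).A (nL κ Φ t p O.merged (gOf κ Φ t p O gv) (fOf κ Φ t p O fv)) (hL κ Φ t p O.merged (gOf κ Φ t p O gv) (fOf κ Φ t p O fv)) (vL κ Φ t p O.merged (gOf κ Φ t p O gv) (fOf κ Φ t p O fv)) (vβL κ Φ t p O.merged (gOf κ Φ t p O gv) (fOf κ Φ t p O fv)) ((prFA κ Φ t p O.merged (gOf κ Φ t p O gv) (fOf κ Φ t p O fv))).c₀ ((prFA κ Φ t p O.merged (gOf κ Φ t p O gv) (fOf κ Φ t p O fv))).c₁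 ((prFA κ Φ t p O.merged (gOf κ Φ t p O gv) (fOf κ Φ t p O fv))).D (HK.kgLastLoY N) (HK.kgLastHiY N) 0 ∧
      Skelφ.rdHi ((prFA κ Φ t p O.merged (gOf κ Φ t p O gv) (fOf κ Φ t p O fv))).A (nL κ Φ t p O.merged (gOf κ Φ t p O gv) (fOf κ Φ t p O fv)) (hL κ Φ t p O.merged (gOf κ Φ t p O gv) (fOf κ Φ t p O fv)) (vL κ Φ t p O.merged (gOf κ Φ t p O gv) (fOf κ Φ t p O fv)) (vβL κ Φ t p O.merged (gOf κ Φ t p O gv) (fOf κ Φ t p O fv)) ((prFA κ Φ t p O.merged (gOf κ Φ t p O gv) (fOf κ Φ t p O fv))).c₀ ((prFA κ Φ t p O.merged (gOf κ Φ t p O gv) (fOf κ Φ t p O fv))).c₁ ((prFA κ Φ t p O.merged (gOf κ Φ t p O gv) (fOf κ Φ t p O fv))).D (HK.kgLastLoY N) (HK.kgLastHiY N) 0 ≤ ((fcellsV κ Φ t p O.merged (gOf κ Φ t p O gv) (fOf κ Φ t p O fv) (cOf κ Φ t p O gv fv cv) (hOf κ Φ t p O gv fv hv))).cenS (tgt e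 + stepVec ((((1 : Fin 2), true) : MDir))) 0 - ((fcellsV κ Φ t p O.merged (gOf κ Φ t p O gv) (fOf κ Φ t p O fv) (cOf κ Φ t p O gv fv cv) (hOf κ Φ t p O gv fv hv))).cenS (tgt e) 0 + (bOf κ Φ t p O gv fv bv) 0 - 1 ∧
      -(((fcellsV κ Φ t p O.merged (gOf κ Φ t p O gv) (fOf κ Φ t p O fv) (cOf κ Φ t p O gv fv cv) (hOf κ Φ t p O gv fv hv))).hB 1 : ℤ) ≤ Skelφ.rdLo ((prFA κ Φ t p O.merged (gOf κ Φ t p O gv) (fOf κ Φ t p O fv))).A (nL κ Φ t p O.merged (gOf κ Φ t p O gv) (fOf κ Φ t p O fv)) (hL κ Φ t p O.merged (gOf κ Φ t p O gv) (fOf κ Φ t p O fv)) (vL κ Φ t p O.merged (gOf κ Φ t p O gv) (fOf κ Φ t p O fv)) (vβL κ Φ t p O.merged (gOf κ Φ t p O gv) (fOf κ Φ t p O fv)) ((prFA κ Φ t p O.merged (gOf κ Φ t p O gv) (fOf κ Φ t p O fv))).c₀ ((prFA κ Φ t p O.merged (gOf κ Φ t p O gv) (fOf κ Φ t p O fv))).c₁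 ((prFA κ Φ t p O.merged (gOf κ Φ t p O gv) (fOf κ Φ t p O fv))).D (HK.kgLastLoY N) (HK.kgLastHiY N) 0 ∧
      Skelφ.rdHi ((prFA κ Φ t p O.merged (gOf κ Φ t p O gv) (fOf κ Φ t p O fv))).A (nL κ Φ t p O.merged (gOf κ Φ t p O gv) (fOf κ Φ t p O fv)) (hL κ Φ t p O.merged (gOf κ Φ t p O gv) (fOf κ Φ t p O fv)) (vL κ Φ t p O.merged (gOf κ Φ t p O gv) (fOf κ Φ t p O fv)) (vβL κ Φ t p O.merged (gOf κ Φ t p O gv) (fOf κ Φ t p O fv)) ((prFA κ Φ t p O.merged (gOf κ Φ t p O gv) (fOf κ Φ t p O fv))).c₀ ((prFA κ Φ t p O.merged (gOf κ Φ t p O gv) (fOf κ Φ t p O fv))).c₁ ((prFA κ Φ t p O.merged (gOf κ Φ t p O gv) (fOf κ Φ t p O fv))).D (HK.kgLastLoY N) (HK.kgLastHiY N) 0 ≤ (((fcellsV κ Φ t p O.merged (gOf κ Φ t p O gv) (fOf κ Φ t p O fv) (cOf κ Φ t p O gv fv cv) (hOf κ Φ t p O gv fv hv))).hF 1 : ℤ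))
    -- START-BOX ROWS (`aW ≤ (n ± v) + W`, `bL ≤ qq`)
    {aW Bx bL : ℤ} (ha : ((prFA κ Φ t p O.merged (gOf κ Φ t p O gv) (fOf κ Φ t p O fv))).D * (((prFA κ Φ t p O.merged (gOf κ Φ t p O gv) (fOf κ Φ t p O fv))).c₁ * ((nL κ Φ t p O.merged (gOf κ Φ t p O gv) (fOf κ Φ t p O fv)) : ℤ) * ((bOf κ Φ t p O gv fv bv) 0 + 1) + ((prFA κ Φ t p O.merged (gOf κ Φ t p O gv) (fOf κ Φ t p O fv))).c₀ * |(vL κ Φ t p O.merged (gOf κ Φ t p O gv) (fOf κ Φ t p O fv))| * ((bOf κ Φ t p O gv fv bv) 1 + 1)) ≤ ((prFA κ Φ t p O.merged (gOf κ Φ t p O gv) (fOf κ Φ t p O fv))).c₀ * ((prFA κ Φ t p O.merged (gOf κ Φ t p O gv) (fOf κ Φ t p O fv))).c₁ * ((prFA κ Φ t p O.merged (gOf κ Φ t p O gv) (fOf κ Φ t p O fv))).A * modulus (nL κ Φ t p O.merged (gOf κ Φ t p O gv) (fOf κ Φ t p O fv)) (hL κ Φ t p O.merged (gOf κ Φ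 t p O gv) (fOf κ Φ t p O fv)) (vL κ Φ t p O.merged (gOf κ Φ t p O gv) (fOf κ Φ t p O fv)) (vβL κ Φ t p O.merged (gOf κ Φ t p O gv) (fOf κ Φ t p O fv)) * aW)
    (hBx : ((prFA κ Φ t p O.merged (gOf κ Φ t p O gv) (fOf κ Φ t p O fv))).D * (((bOf κ Φ t p O gv fv bv) 1 : ℤ) + 1) ≤ ((prFA κ Φ t p O.merged (gOf κ Φ t p O gv) (fOf κ Φ t p O fv))).c₁ * ((prFA κ Φ t p O.merged (gOf κ Φ t p O gv) (fOf κ Φ t p O fv))).A * Bx) (hbL : Bx / (Skelφ.shearUnit (nL κ Φ t p O.merged (gOf κ Φ t p O gv) (fOf κ Φ t p O fv)) (hL κ Φ t p O.merged (gOf κ Φ t p O gv) (fOf κ Φ t p O fv)) : ℤ) + 1 ≤ bL)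
    (haW : aW ≤ (((((nL κ Φ t p O.merged (gOf κ Φ t p O gv) (fOf κ Φ t p O fv)) : ℤ) + (vL κ Φ t p O.merged (gOf κ Φ t p O gv) (fOf κ Φ t p O fv))).toNat + W : ℕ) : ℤ)) (haW' : aW ≤ (((((nL κ Φ t p O.merged (gOf κ Φ t p O gv) (fOf κ Φ t p O fv)) : ℤ) - (vL κ Φ t p O.merged (gOf κ Φ t p O gv) (fOf κ Φ t p O fv))).toNat + W : ℕ) : ℤ)) (hbq : bL ≤ qq)
    -- DEPTH ROW
    (hRD : ((cOffS κ Φ t p O.merged (gOf κ Φ t p O gv) (fOf κ Φ t p O fv) * (((tgt e) 0).natAbs + ((tgt e) 1).natAbs) + 1 : ℕ) : ℤ) +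
      (10 + 3) * (((N : ℤ) + 1) * (((nL κ Φ t p O.merged (gOf κ Φ t p O gv) (fOf κ Φ t p O fv)) * (ℓL κ Φ t p O.merged (gOf κ Φ t p O gv) (fOf κ Φ t p O fv)) / Skelφ.shearUnit (nL κ Φ t p O.merged (gOf κ Φ t p O gv) (fOf κ Φ t p O fv)) (hL κ Φ t p O.merged (gOf κ Φ t p O gv) (fOf κ Φ t p O fv)) + 1 : ℕ) : ℤ) +
        Skelφ.kgZY₀ (nL κ Φ t p O.merged (gOf κ Φ t p O gv) (fOf κ Φ t p O fv)) (vL κ Φ t p O.merged (gOf κ Φ t p O gv) (fOf κ Φ t p O fv)) (KS0.R'0 κ Φ t p O.merged mk) ρ W N (Skelφ.kgM₁Y (nL κ Φ t p O.merged (gOf κ Φ t p O gv) (fOf κ Φ t p O fv)) (vL κ Φ t p O.merged (gOf κ Φ t p O gv) (fOf κ Φ t p O fv)) (KS0.R'0 κ Φ t p O.merged mk) ρ W N) (Skelφ.kgWm₂Y (nL κ Φ t p O.merged (gOf κ Φ t p O gv) (fOf κ Φ t p O fv)) (vL κ Φ t p O.merged (gOf κ Φ t p O gv) (fOf κ Φ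 t p O fv)) (KS0.R'0 κ Φ t p O.merged mk) ρ W N) (Skelφ.kgWp₂Y (nL κ Φ t p O.merged (gOf κ Φ t p O gv) (fOf κ Φ t p O fv)) (vL κ Φ t p O.merged (gOf κ Φ t p O gv) (fOf κ Φ t p O fv)) (KS0.R'0 κ Φ t p O.merged mk) ρ W N) (Skelφ.kgM₂Y (nL κ Φ t p O.merged (gOf κ Φ t p O gv) (fOf κ Φ t p O fv)) (ℓL κ Φ t p O.merged (gOf κ Φ t p O gv) (fOf κ Φ t p O fv)) (hL κ Φ t p O.merged (gOf κ Φ t p O gv) (fOf κ Φ t p O fv)) (vL κ Φ t p O.merged (gOf κ Φ t p O gv) (fOf κ Φ t p O fv)) (KS0.R'0 κ Φ t p O.merged mk) ρ qq W N) + Skelφ.kgZY₁ (nL κ Φ t p O.merged (gOf κ Φ t p O gv) (fOf κ Φ t p O fv)) (ℓL κ Φ t p O.merged (gOf κ Φ t p O gv) (fOf κ Φ t p O fv)) (hL κ Φ t p O.merged (gOf κ Φ t p O gv) (fOf κ Φ t p O fv)) (KS0.R'0 κ Φ t p O.merged mk) ρ qq N (Skelφ.kgM₁Y (nL κ Φ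 t p O.merged (gOf κ Φ t p O gv) (fOf κ Φ t p O fv)) (vL κ Φ t p O.merged (gOf κ Φ t p O gv) (fOf κ Φ t p O fv)) (KS0.R'0 κ Φ t p O.merged mk) ρ W N) (Skelφ.kgM₂Y (nL κ Φ t p O.merged (gOf κ Φ t p O gv) (fOf κ Φ t p O fv)) (ℓL κ Φ t p O.merged (gOf κ Φ t p O gv) (fOf κ Φ t p O fv)) (hL κ Φ t p O.merged (gOf κ Φ t p O gv) (fOf κ Φ t p O fv)) (vL κ Φ t p O.merged (gOf κ Φ t p O gv) (fOf κ Φ t p O fv)) (KS0.R'0 κ Φ t p O.merged mk) ρ qq W N)) ≤ R)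
    -- THE RIM EXCESS DEVICE: world rows, excess radius
    {φe : V → Site 2} {Rw m' m R₁ : ℕ} {ctr : Site 2}
    (hWπ : ∀ b ∈ (((KSchA.mk (ΓQV κ Φ t p O gv fv Sv cv hv bv q) q κ.δ : KSchA V ℕ))).Γ.Ewv ((((KSchA.mk (ΓQV κ Φ t p O gv fv Sv cv hv bv q) q κ.δ : KSchA V ℕ))).aOf₁O G h e) e.1 e.2 ∪ ((FDQV κ Φ t p O gv fv Sv cv hv q)).Hfull ((((KSchA.mk (ΓQV κ Φ t p O gv fv Sv cv hv bv q) q κ.δ : KSchA V ℕ))).aOf₂O G h e) (tgt e) ((((1 : Fin 2), true) : MDir)), b ∈ graphBall G t Rw)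
    (hWpl : ∀ b ∈ (((KSchA.mk (ΓQV κ Φ t p O gv fv Sv cv hv bv q) q κ.δ : KSchA V ℕ))).Γ.Ewv ((((KSchA.mk (ΓQV κ Φ t p O gv fv Sv cv hv bv q) q κ.δ : KSchA V ℕ))).aOf₁O G h e) e.1 e.2 ∪ ((FDQV κ Φ t p O gv fv Sv cv hv q)).Hfull ((((KSchA.mk (ΓQV κ Φ t p O gv fv Sv cv hv bv q) q κ.δ : KSchA V ℕ))).aOf₂O G h e) (tgt e) ((((1 : Fin 2), true) : MDir)), φe b ∈ (box 2 m').image (fun s => s + ctr))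
    (hm : 2 * m' ≤ m)
    (hR₁ : ∀ R'', R₁ ≤ R'' → ∀ (Rw' : ℕ) (D' A' : Finset V), (∀ d ∈ D', d ∈ graphBall G t Rw') →
      (∀ d ∈ D', ∀ d' ∈ D', φe d - φe d' ∈ box 2 m) → A' ⊆ D' → (∀ a ∈ A', a ∈ graphBall G t (R₀ + 1)) →
        (bondPercolation G q).real (excess G t R'' D' A') ≤ κ.δr 0 / 2)
    (hR₁R : R₁ ≤ R - KS0.r₀0 t O.merged mk (RL κ Φ t p O gv fv))
    -- the budget
    {nmax : ℕ} (hnmax : (Skelφ.kgCorrSchedYU HK.hn HK.hv HK.hlay (HK.kgYVals_ok₁ N) (HK.kgYVals_ok₂ N) (HK.kgYVals_split N)).N ≤ nmax) :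
    ReachOblAtHNF G nmax ((KSchA.mk (ΓQV κ Φ t p O gv fv Sv cv hv bv q) q κ.δ : KSchA V ℕ)) (FDQV κ Φ t p O gv fv Sv cv hv q) Φ.Δ (κ.δr 0) h e ((((KSchA.mk (ΓQV κ Φ t p O gv fv Sv cv hv bv q) q κ.δ : KSchA V ℕ))).aOf₂O G h e) ((((1 : Fin 2), true) : MDir)) := by
  -- the long clause and its numerics
  have hN := eqNumL_of_atQV hAt
  obtain ⟨hn1, hℓ1⟩ := one_le_of_eqNumL κ Φ t p O.merged (gOf κ Φ t p O gv) (fOf κ Φ t p O fv) hN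
  have hκL := (clauseL_of_atQV hAt).2
  obtain ⟨-, hq1, hq2, -⟩ := factsNS_of_atQV hAt
  -- the frame
  have hlipφ := lip_φL κ Φ t p O.D O.DT.toDataN O.ori (gOf κ Φ t p O gv) (fOf κ Φ t p O fv)
  have hstep := steps_φL κ Φ t p O.D O.DT.toDataN O.ori (gOf κ Φ t p O gv) (fOf κ Φ t p O fv)
  -- the Γ package at the staggered cells
  obtain ⟨-, -, -, -, -, -, hEx, hSt, hLG⟩ := geom_fineA_at_bV κ Φ t p O.merged (gOf κ Φ t p O gv) (fOf κ Φ t p O fv) (cOf κ Φ t p O gv fv cv) (hOf κ Φ t p O gv fv hv) hlipφ hstep hN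
    (schedOfT_WFS2 κ Φ t p O.merged (gOf κ Φ t p O gv) (fOf κ Φ t p O fv) (cOf κ Φ t p O gv fv cv) (Sv κ Φ t p O.merged (gOf κ Φ t p O gv) (fOf κ Φ t p O fv) q)) (colQ_schedOfT κ Φ t p O.merged (gOf κ Φ t p O gv) (fOf κ Φ t p O fv) (cOf κ Φ t p O gv fv cv) (Sv κ Φ t p O.merged (gOf κ Φ t p O gv) (fOf κ Φ t p O fv) q))
    (b₀ := (bOf κ Φ t p O gv fv bv)) (bOf_leV κ Φ t p O gv fv cv hv bv)
  -- the kit block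
  obtain ⟨hPN, hdD, hDρ, hKCmax, hT, -⟩ := KS0.kit0_ok t O.merged mk ((Mu O.merged + 1 : ℕ) * (Skelφ.shearUnit (nL κ Φ t p O.merged (gOf κ Φ t p O gv) (fOf κ Φ t p O fv)) (hL κ Φ t p O.merged (gOf κ Φ t p O gv) (fOf κ Φ t p O fv)) : ℤ) + 1)
    (KS0.r₀0 t O.merged mk (RL κ Φ t p O gv fv)) (kq := 10) le_rfl
  obtain ⟨hrs, hcS⟩ := KS0.kit0_sizes Φ t O.merged mk ((Mu O.merged + 1 : ℕ) * (Skelφ.shearUnit (nL κ Φ t p O.merged (gOf κ Φ t p O gv) (fOf κ Φ t p O fv)) (hL κ Φ t p O.merged (gOf κ Φ t p O gv) (fOf κ Φ t p O fv)) : ℤ) + 1) (KS0.r₀0 t O.merged mk (RL κ Φ t p O gv fv))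
  obtain ⟨hr₀, hr₀1⟩ := KS0.hr₀_kit0 t O.merged mk ((Mu O.merged + 1 : ℕ) * (Skelφ.shearUnit (nL κ Φ t p O.merged (gOf κ Φ t p O gv) (fOf κ Φ t p O fv)) (hL κ Φ t p O.merged (gOf κ Φ t p O gv) (fOf κ Φ t p O fv)) : ℤ) + 1) (KS0.r₀0_ge t O.merged mk (RL κ Φ t p O gv fv)).1
  have hreach := KS0.hreach_kit0 t O.merged mk ((Mu O.merged + 1 : ℕ) * (Skelφ.shearUnit (nL κ Φ t p O.merged (gOf κ Φ t p O gv) (fOf κ Φ t p O fv)) (hL κ Φ t p O.merged (gOf κ Φ t p O gv) (fOf κ Φ t p O fv)) : ℤ) + 1) (KS0.r₀0_ge t O.merged mk (RL κ Φ t p O gv fv)).2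
  -- the counts at the flat root accuracy
  obtain ⟨hk, hcount⟩ := KS0.counts_atq_root κ Φ t p O.merged mk hp0 hp1 hq1 hq2
  -- levels
  have hE : KS0.j₁0 κ Φ t p O.merged mk +
      ((KS0.kit0 t O.merged mk ((Mu O.merged + 1 : ℕ) * (Skelφ.shearUnit (nL κ Φ t p O.merged (gOf κ Φ t p O gv) (fOf κ Φ t p O fv)) (hL κ Φ t p O.merged (gOf κ Φ t p O gv) (fOf κ Φ t p O fv)) : ℤ) + 1) (KS0.r₀0 t O.merged mk (RL κ Φ t p O gv fv))).N *
          (tanOff (KS0.kit0 t O.merged mk ((Mu O.merged + 1 : ℕ) * (Skelφ.shearUnit (nL κ Φ t p O.merged (gOf κ Φ t p O gv) (fOf κ Φ t p O fv)) (hL κ Φ t p O.merged (gOf κ Φ t p O gv) (fOf κ Φ t p O fv)) : ℤ) + 1) (KS0.r₀0 t O.merged mk (RL κ Φ t p O gv fv))).ℓs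
            (KS0.kit0 t O.merged mk ((Mu O.merged + 1 : ℕ) * (Skelφ.shearUnit (nL κ Φ t p O.merged (gOf κ Φ t p O gv) (fOf κ Φ t p O fv)) (hL κ Φ t p O.merged (gOf κ Φ t p O gv) (fOf κ Φ t p O fv)) : ℤ) + 1) (KS0.r₀0 t O.merged mk (RL κ Φ t p O gv fv))).M + 1) +
        (KS0.kit0 t O.merged mk ((Mu O.merged + 1 : ℕ) * (Skelφ.shearUnit (nL κ Φ t p O.merged (gOf κ Φ t p O gv) (fOf κ Φ t p O fv)) (hL κ Φ t p O.merged (gOf κ Φ t p O gv) (fOf κ Φ t p O fv)) : ℤ) + 1) (KS0.r₀0 t O.merged mk (RL κ Φ t p O gv fv))).N *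
          (KS0.kit0 t O.merged mk ((Mu O.merged + 1 : ℕ) * (Skelφ.shearUnit (nL κ Φ t p O.merged (gOf κ Φ t p O gv) (fOf κ Φ t p O fv)) (hL κ Φ t p O.merged (gOf κ Φ t p O gv) (fOf κ Φ t p O fv)) : ℤ) + 1) (KS0.r₀0 t O.merged mk (RL κ Φ t p O gv fv))).d +
        KS.KCmax t O.merged mk) ≤ KS0.R'0 κ Φ t p O.merged mk := by
    rw [KS0.tanOff_kit0]
    simp only [KS0.kit0]
    have h := (KS0.R'0_eq κ Φ t p O.merged mk).1
    unfold KS0.reach0 at h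
    omega
  exact Skelφ.reachOblAtHNF_of_kgCorrYVU (φ := (φL κ Φ t p O.D O.DT.toDataN O.ori (gOf κ Φ t p O gv) (fOf κ Φ t p O fv))) (ψ := (fineOA κ Φ t p O.D O.DT.toDataN O.ori (gOf κ Φ t p O gv) (fOf κ Φ t p O fv))) (P := (fcellsV κ Φ t p O.merged (gOf κ Φ t p O gv) (fOf κ Φ t p O fv) (cOf κ Φ t p O gv fv cv) (hOf κ Φ t p O gv fv hv))) (w₀ := t) (Λ := (schedOfT κ Φ t p O.merged (gOf κ Φ t p O gv) (fOf κ Φ t p O fv) (cOf κ Φ t p O gv fv cv) (Sv κ Φ t p O.merged (gOf κ Φ t p O gv) (fOf κ Φ t p O fv) q))) (b₀ := (bOf κ Φ t p O gv fv bv)) (q := q) (δc := κ.δ)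
    (hψ := fineOA_eq_fineSkel) (hAp := (Aof_pos κ).1) (hmp := Skelφ.NegPrm.modulus_vβOf_pos hn1 hℓ1 _ _)
    (hc₀p := (prFA_c_pos κ Φ t p O.merged (gOf κ Φ t p O gv) (fOf κ Φ t p O fv)).1) (hc₁p := (prFA_c_pos κ Φ t p O.merged (gOf κ Φ t p O gv) (fOf κ Φ t p O fv)).2)
    (hDp := Skelφ.NegPrm.DofA_pos (Aof_pos κ).2 hn1 hℓ1 _ _)
    (hlip := lip_fineA_at κ Φ t p O.merged (gOf κ Φ t p O gv) (fOf κ Φ t p O fv) hlipφ hN) (hws := weakSteps_fineA_at κ Φ t p O.merged (gOf κ Φ t p O gv) (fOf κ Φ t p O fv) hstep hN)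
    (hb := bOf_leV κ Φ t p O gv fv cv hv bv) (hL := hLG) (hSt := hSt) (hEx := hEx) (hV := hV) (hdu := hdu) (hdu' := hne)
    (hlipφ := hlipφ) (hstep := hstep) (hΔ := Φ.degree_le) (hn := HK.hn) (hvn := HK.hv) (hlay := HK.hlay)
    (c₀ := colVT κ Φ t p O.merged (gOf κ Φ t p O gv) (fOf κ Φ t p O fv) (cOf κ Φ t p O gv fv cv) hlipφ hstep hN (tgt e)) (kq := 10) (hκL := hκL)
    (hctr := colVT_eq κ Φ t p O.merged (gOf κ Φ t p O gv) (fOf κ Φ t p O fv) (cOf κ Φ t p O gv fv cv) hlipφ hstep hN (tgt e))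
    (hP₁ := HK.kgYVals_ok₁ N) (hP₂ := HK.kgYVals_ok₂ N) (hsplit := HK.kgYVals_split N) (r := RL κ Φ t p O gv fv) (hr := le_rfl)
    (hrR := le_trans (Nat.le_add_right _ _) ((KS0.r₀0_ge t O.merged mk (RL κ Φ t p O gv fv)).2.trans hr₀R))
    (Pk := KS0.kit0 t O.merged mk ((Mu O.merged + 1 : ℕ) * (Skelφ.shearUnit (nL κ Φ t p O.merged (gOf κ Φ t p O gv) (fOf κ Φ t p O fv)) (hL κ Φ t p O.merged (gOf κ Φ t p O gv) (fOf κ Φ t p O fv)) : ℤ) + 1) (KS0.r₀0 t O.merged mk (RL κ Φ t p O gv fv)))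
    (hPN := hPN) (hA := rfl) (hdD := hdD) (hDρ := hDρ) (hKCmax := hKCmax) (hT := hT) (hr₀ := hr₀) (hR := hr₀R) (hr₀1 := hr₀1)
    (hrs := hrs) (hcS := hcS) (hreach := hreach)
    (Rg := fun c => KS.RgK G t O.merged mk (KS.φK Φ t O.D O.DT.toDataN O.ori mk) c)
    (hRg := fun c => KS.RgK_subset_graphBall t O.merged mk _ c) (hRgcard := fun c => KS.card_RgK_le Φ t O.merged mk _ c)
    (hcU1 := Nat.one_le_pow _ _ (Nat.succ_pos _))
    (Λc := O.merged.Λ) (kz := Mu O.merged) (hΛRg := hΛRg_of_atQV mk hAt) (hzconn := hzconn_of_atQV hAt) (hcz := hcz_of_atQV hAt)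
    (hj0 := (KS0.tanOff_kit0 t O.merged mk _ _).le) (hj := (KS0.R'0_eq κ Φ t p O.merged mk).2.2) (hRl := (KS0.R'0_eq κ Φ t p O.merged mk).2.1.le)
    (hE := hE) (hδ := (κ.hδr 0).1) (hη := le_rfl) (kk := KS0.kk0 κ Φ t p O.merged mk) (hN := KS0.hNk0_at κ Φ t p O.merged mk hp0 hp1)
    (hk := hk) (hcount := hcount)
    (hDQ := hDQ) (hDρ' := hDρ') (hρM := hρM) (hdeep := hdeep) (hPR := hPR) (hlast := fun y hy => HK.mem_Icc_of_mem_lastY N hy) (hLl := hLl) (hLt := hLt)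
    (ha := ha) (hBx := hBx) (hbL := hbL) (haW := haW) (haW' := haW') (hbq := hbq)
    (hc₀ := colVT_mem_graphBall_lin κ Φ t p O.merged (gOf κ Φ t p O gv) (fOf κ Φ t p O fv) (cOf κ Φ t p O gv fv cv) hlipφ hstep hN hκL (tgt e)) (hRD := hRD)
    (hWπ := hWπ) (hWpl := hWpl) (hm := hm) (hR₁ := hR₁) (hR₁R := hR₁R)
    (hlong := hlong_of_atQ3V hAt h1 (Neg.δkit_le_δr κ Φ (by norm_num)))
    (hlongY := hlongY_of_atQ3V hAt h1 (Neg.δkit_le_δr κ Φ (by norm_num)))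
    (hnmax := hnmax)

end Fst

end NegB

end PlanarSkeletonFrm

end Summit.CriticalPhenomena.PercolationContinuityZ3.Theorems.Transplant

end
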